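import Summits.HodgeConjecture.HodgeConjecture.Theorems.SplitImpliesAllTypeIIMembers
import HarnessLib

/-!
# `SplitImpliesAll` — TYPE-II POINTEDNESS of every cell `(ℚ(√-d), 2n, δ)` modulo Deligne's period construction J1, BY NAME

(Part B = §4–§5. Part A, `Theorems/SplitImpliesAllTypeIIMembers`, holds §0–§3: the type-II member of every right-sign cell and the
isogeny transport of its anchor class — the file authored by vhodge-typer-1 g0, sha16 1a6cf2258863e468, was split in two by the
filing seat vhodge P3 g18 to meet the 400-line rule for Theorems files; no mathematical content changed.)

SUPPORT file for item stmt-HodgeConjecture-19149 (`SplitImpliesAll.NonsplitSixfoldCells`, K1; registered germ-currency stub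
`Cruxes/NonsplitSixfoldCells/Lines/birth.lean: stub_rung_firstCell_typeIIPointed :
PointedWeilFamiliesComponent 3 3 [-2] (SplitImpliesAllTypeIIAnchorGerm.antiCompatibleAnchor 3 3)`, vhodge seat P3 gen 17,
memo ROUTE-P3-g17 §3/§5 task 2). The seat's type-II anchor file (`Theorems/SplitImpliesAllTypeIIAnchorGerm`) proved, FACT-FREE,
that an anti-compatible algebraic degree-two class of non-zero top power on a chart of the marked fibre makes the fibre's Weil
plane algebraic (`antiCompatibleAnchor_valid`), and reduced the K1 cell, granted TYPE-II POINTEDNESS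
(P) `Ring2.Hypotheses.PointedWeilFamiliesComponent n d δ (antiCompatibleAnchor n d)`, to ONE local germ statement (L) at the
anti-compatible anchor. This file DISCHARGES (P) on EVERY cell `(n, d, δ)`, `n, d ≥ 1`, modulo the ONE named Literature fact
`deligne1982_weilFamily_periodConstructionAtWeilType` («J1», Deligne 1982 §4 proof of Thm. 4.8 with van Geemen 1994, 5.3–5.5;
UNPROVED named fact, a HYPOTHESIS below) — exactly the currency of the template `Theorems/SplitImpliesAllNonsplitCellsConnectedOfJ1`
(p415093, K3 ⟸ J1), whose family-first reach package `CellSystemReachAt` / `cellSystemReachAt_of_J1` and Deligne's 1968 global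
invariant cycle theorem (tree theorem `deligne1968_invariantClass_fromTotalSpace_holds`) are re-used verbatim.

## The argument (memo §3 (a), (d), (e); the anchor member is the CM point of the type-II locus)

* §1 THE ANCHOR CLASS ON THE CM SQUARE (`n = 1`). On `(E₀ × E₀, ψ₀ × (-ψ₀))`, `ψ₀² = -d`, the rational Weil class
  `y₁ = u₊ + u₋ ∈ W_K ⊂ H²` is ALGEBRAIC (Schoen's shear divisors, tree `weilClassesPlus/Minus_cmSquare_le_algebraicClasses`),
  ANTI-COMPATIBLE (`φ^* = (√-d)² = -d` on `⋀²_K H¹`, tree `map_eq_smul_of_mem_weilClassesOf`) and has `y₁ ⌣ y₁ ≠ 0` (the rational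
  Weil plane is anisotropic, tree `cupProduct_self_ne_zero_of_isRationalClass_of_mem_weilClassesOf`). [vanGeemen1994HodgeAV 5.3;
  Schoen1998HodgeWeilAddendum §10]
* §2 THE CM TOWER WITH ITS ANCHOR CLASS. Ring 2's CM tower (`Ring2AbelianAllWeilCellsInhabited.exists_member`: every right-sign
  class `δ` is the discriminant class of a product of CM squares with Segre weights, `det H` multiplicative) is re-run carrying
  the class `y = Σ prᵢ^* y₁`: algebraic (pull-backs along homomorphisms, sums), anti-compatible (`(φ × ψ)^* prᵢ^* = prᵢ^* φᵢ^*`),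
  rational, of non-zero top power (`(pr_A^* y_A + pr_B^* y_B)^{2n+2} = C(2n+2, 2n)·y_A^{2n} ⊠ y_B² ≠ 0`, the tree's
  `lefschetzPow_add_map_self` + Künneth). So EVERY right-sign cell `(n, d, δ)` contains a member `E₀ⁿ × Ē₀ⁿ` carrying an algebraic
  anti-compatible class with `y^{2n} ≠ 0` — a CM point OF the type-II locus (`⟨ι(K), β⟩`, `β(x, y) = (b·y, x)`, ring-2 account
  TYPEII-ANCHOR-G22 §1.1 (a): `X × X̄ ∈ 𝔔(D)` for every `K`-threefold `X`, instance `X = E₀³`), NOT its general (simple) member.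
* §3 TRANSPORT ALONG A `K`-ISOGENY `u : Y → B`, `u ∘ Ψ = φ_B ∘ u`: `u^* y` is algebraic, anti-compatible for `Ψ`, and
  `(u^* y)^{2n} = u^*(y^{2n}) ≠ 0` (`u^*` is bijective on `H^•`, tree `complexBetti_map_bijective_of_isIsogeny`).
* §4 (P) FROM THE CELL'S REACH PACKAGE AND L (the template's M1ᶜ with a different last line): run the package AT THE TARGET
  `(A, φ, h_K(e,a))`; the flat section through `c` is the restriction of a global class `W` (L + uniqueness of flat continuation),
  fibrewise rational `(n,n)` in the Weil planes, reading `c` at `s₁`, every fibre `δ`-charted; the far end is the §2 member of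
  class `δ` (right sign from the target, `weilSign_eq_of_hasWeilDiscriminantNondeg`): some fibre `Y_{s₀}` is `K`-isogenous to it,
  and §3 makes `(Y_{s₀}, Ψ_{s₀}, ε_{s₀})` an anti-compatible anchor chart — `antiCompatibleAnchor n d 𝒳_{s₀} (W|)` verbatim.
* §5 (P) FOR EVERY CELL MODULO J1 (`typeIIPointed_of_J1`); the registered stub (`typeII_firstCell_pointed_of_J1`); and, with the
  anchor file's exactness, J1 ⊢ (cell ↔ VHC-instance ↔ type-II germ) per cell, J1 ⊢ (K1 ↔ type-II germ on the non-split
  right-sign sixfold cells), J1 + Markman ⊢ (W₆ ↔ that germ), J1 ⊢ (BC5 rung `stub_rung_firstCell` ↔ L₆).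

HONEST LABEL. J1 is a hypothesis, never asserted; (L) stays OPEN and is the research content of K1; nothing here proves a case
of the Hodge conjecture, `W₆`, `HC_AV` or HC; `HC_CM` occurs nowhere; no new definition, no named fact, 0 sorries. WHAT THIS
DOES NOT GIVE: pointedness at a GENERIC type-II member (simple, `End⁰ = D_δ`) — that needs J1's period surjectivity onto the
Siegel sub-domain `𝔖ₙ` plus Riemann's theorem (fullness half) to realise `β` as an endomorphism of the fibre (memo §3 (b)–(c));
the registered germ statement (L) quantifies over ALL anti-compatibly anchored fibres, so the stub is closed modulo J1 as
registered, and granted J1 the K1 cell is EQUIVALENT to (L).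

References: [Deligne1982HodgeCycles] §4 Prop. 4.1, 4.4, proof of Thm. 4.8, Rem. 4.10; [vanGeemen1994HodgeAV] 4.9–4.14, Lemma 5.2,
5.3–5.5, 6.12; [Deligne1968] Prop. (2.1), (2.6.3); [Schoen1998HodgeWeilAddendum] §10; [MoonenZarhin1998WeilClasses] §1–2;
[Shimura1963AnalyticFamilies] §4; [LangeBirkenhake1992] §5.3; [MumfordAV1970] §19; [CharlesSchnell2014Notes] Conj. 11.3.1,
Prop. 11.3.11; [Markman2025SecantWeil] Thm. 1.5.1 (preprint, unrefereed).
-/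


set_option linter.dupNamespace false

open CategoryTheory AlgebraicGeometry Limits MonoidalCategory CartesianMonoidalCategory
open Literature.AlgebraicGeometry Literature.AlgebraicGeometry.Motives
open Literature.AlgebraicGeometry.Motives.SegreHyperplaneClass
open Literature.AlgebraicGeometry.HodgeTheory
open Literature.AlgebraicGeometry.VanGeemen1994
open Literature.AlgebraicTopology.SingularHomology
open Literature.Geometry.Kaehler
open Summit.HodgeConjecture.HodgeConjecture.Ring2.Hypotheses
open Summit.HodgeConjecture.HodgeConjecture.Ring2.AbelianAll
open Summit.HodgeConjecture.HodgeConjecture.Theorems.SplitImpliesAllNonsplitCellsConnectedOfJ1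
open Summit.HodgeConjecture.HodgeConjecture.Theorems.SplitImpliesAllTypeIIAnchorGerm

open Summit.HodgeConjecture.HodgeConjecture.Theorems.SplitImpliesAllTypeIIMembers

namespace Summit.HodgeConjecture.HodgeConjecture.Theorems.SplitImpliesAllTypeIIPointedOfJ1

/-! ## §4 (P) — type-II pointedness of the cell from its reach package and L -/

variable {n d : ℕ}

/-- **TYPE-II POINTEDNESS OF THE CELL `(n, d, δ)` FROM ITS REACH PACKAGE AND L** (`n, d ≥ 1`, every `δ`; no `HC_CM`, no Hodge
conjecture). Given a target `(A, φ, h_K(e,a))` of exact class `δ` with a non-zero rational `(n,n)` Weil class `c`: run the package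
AT THE TARGET (`e' : A ≅ 𝒳_{s₁}` a fibre chart); the flat section through `c` is at `s₁` the restriction of a global class
`W ∈ H^{2n}(𝒳)` (L), hence everywhere (uniqueness of flat continuation, `isCoveringMap_fiberClassPt`); `W` is fibrewise rational
of type `(n,n)` in the Weil planes, reads `c` at `s₁`, and every fibre is `δ`-charted — verbatim the template's M1ᶜ. The far
end is the CM point of the TYPE-II LOCUS: the cell has the right sign (from the target), so §2's member `(B, φ_B, h_K)` of exact
class `δ` with its anti-compatible class `y` is a target of the package — some fibre `Y_{s₀}` is `K`-isogenous to it
(`u ≫ φ_B = Ψ_{s₀} ≫ u`), and `(Y_{s₀}, Ψ_{s₀}, ε_{s₀}; u^*y)` is `antiCompatibleAnchor n d 𝒳_{s₀} (W|)` verbatim (§3).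
[cite: Deligne1982HodgeCycles, §4, proof of Thm. 4.8 (a)–(c)] [cite: Deligne1968, Prop. (2.1) with (2.6.3)]
[cite: vanGeemen1994HodgeAV, 4.11, 4.14, Lemma 5.2 (3), 5.3–5.5] [cite: MoonenZarhin1998WeilClasses, §2]
[cite: Shimura1963AnalyticFamilies, §4] -/
theorem typeIIPointed_of_cellSystemReachAt (hn : 1 ≤ n) (hd : 1 ≤ d) {δ : weilNormResidueGroup d}
    (hF : CellSystemReachAt n d δ (CellFibre n d δ)) (hL : deligne1968_invariantClass_fromTotalSpace) :
    PointedWeilFamiliesComponent n d δ (antiCompatibleAnchor n d) := by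
  intro A φ hA _ hφ eA aA haA haA0 hδA c hcQ hcH hcW hc0
  have hn0 : 0 < n := hn
  have hd0 : 0 < d := hd
  have hWA : IsWeilType A φ n d := isWeilType_of_weilClass_ne_zero hn0 hd0 hA hφ hcW hc0 hcH
  have hsign : weilSign d δ = (-1) ^ n := weilSign_eq_of_hasWeilDiscriminantNondeg hWA eA haA haA0 hδA
  -- the package AT THE TARGET
  obtain ⟨𝒳, S, f, s₁, e', Y, Ψ, ε, hfam, hemb, hirr, hsm, hSqp, hYΨ, hRfib, hsec, hreach⟩ :=
    hF A φ eA aA hA hφ haA haA0 ⟨c, hcW, hc0, hcH⟩ hδA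
  -- the CM point of the type-II locus of the cell (§2) and the reach to it, with the transported anchor class (§3)
  obtain ⟨B, φB, eB, aB, hB, hφB, haB, haB0, hwB, hNB, y, hya, hyc, hyt⟩ := exists_typeIIMember hn0 hd0 hsign
  obtain ⟨s₀, u, hu, hcomm⟩ := hreach B φB eB aB hB hφB haB haB0 hwB hNB
  obtain ⟨hy'a, hy'c, hy't⟩ := antiCompatibleClass_map_of_isIsogeny hu hcomm hya hyc hyt
  -- base topology: `S(ℂ)` is a connected manifold and `R^{2n} f_* ℂ` is a local system on it
  haveI := hsm
  haveI := hirr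
  haveI : LocallyOfFiniteType S.hom := hSqp.locallyOfFiniteType
  haveI : ConnectedSpace (ComplexPoints S) := (Motives.ComplexPoints.connectedSpace_iff_holds S).2 inferInstance
  obtain ⟨dS, hdS⟩ := exists_smoothOfRelativeDimension_of_connectedSpace_complexPoints S
  haveI := hdS
  haveI := pathConnectedSpace_complexPoints_of_smoothOfRelativeDimension S dS
  have hUc : IsCohomologicallyLocallyTrivialOn f (Set.univ : Set (ComplexPoints S)) :=
    isCohomologicallyLocallyTrivialOn_univ_of_isSmoothProjectiveFamily f dS hfam hSqp
  -- the total space is quasi-projective (closed in `ℙᴺ × S`)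
  obtain ⟨N, ι, hιci, -⟩ := hemb
  haveI := hιci
  have h𝒳 : IsQuasiProjectiveOver 𝒳 := IsQuasiProjectiveOver.of_isClosedImmersion_projectiveSpace_tensor ι hSqp
  -- the flat section through `c` IS the restriction of a global class `W`
  obtain ⟨σ, hσc, hσ₀, hval⟩ := hsec c hcW
  have hpt : ∀ s, (σ s).pt = s := fun s => by
    obtain ⟨x, hx, -⟩ := hval s
    rw [hx]
  obtain ⟨W, hW₀⟩ := hL 𝒳 S f (2 * n) hfam h𝒳 hSqp hsm (2 * n) σ hσc hpt s₁
  have hσW : σ = globalSection f (2 * n) W :=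
    (isCoveringMap_fiberClassPt f (2 * n) hUc).eq_of_comp_eq hσc (continuous_globalSection f (2 * n) W)
      (funext fun s => by
        show (σ s).pt = (globalSection f (2 * n) W s).pt
        rw [hpt s]
        rfl) s₁ hW₀
  have hWval : ∀ s, IsOfHodgeType (2 * n) (fiberOver f s) (2 * n) n n (complexBetti.map (fiberι f s) (2 * n) W) ∧
      complexBetti.map (ε s).hom (2 * n) (complexBetti.map (fiberι f s) (2 * n) W) ∈ weilClassesOf (Y s) (Ψ s) n d := by
    intro s
    obtain ⟨x, hx, hxH, hxW⟩ := hval s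
    rw [hσW] at hx
    have hx' : complexBetti.map (fiberι f s) (2 * n) W = x := (FiberClass.mk_eq_mk_iff _ _).1 hx
    rw [hx']
    exact ⟨hxH, hxW⟩
  -- `W` reads `c` at `s₁` through `e'`
  have hW₀' : complexBetti.map (fiberι f s₁) (2 * n) W = complexBetti.map e'.inv (2 * n) c := by
    rw [hσW] at hσ₀
    exact (FiberClass.mk_eq_mk_iff _ _).1 hσ₀
  have hread : complexBetti.map e'.hom (2 * n) (complexBetti.map (fiberι f s₁) (2 * n) W) = c := by
    rw [hW₀', e'.complexBetti_map_hom_map_inv]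
  -- `W` is fibrewise rational (flat transport of the rational class `e'⁻¹* c`)
  have hWQ : ∀ s, IsRationalClass (complexBetti.map (fiberι f s) (2 * n) W) := by
    intro s
    have hQ₀ : IsRationalClass (complexBetti.map (fiberι f s₁) (2 * n) W) := by
      rw [hW₀']
      exact (isRationalClass_map_iff_of_iso e'.symm).2 hcQ
    obtain ⟨γ⟩ : Nonempty (Path.Homotopic.Quotient (⟨s₁, Set.mem_univ s₁⟩ : (Set.univ : Set (ComplexPoints S))) ⟨s, Set.mem_univ s⟩) :=
      ⟨⟦(PathConnectedSpace.somePath s₁ s).map (continuous_id.subtype_mk _)⟧⟩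
    have htr : transportFun f (2 * n) hUc γ (complexBetti.map (fiberι f s₁) (2 * n) W) = complexBetti.map (fiberι f s) (2 * n) W :=
      transportFun_map_fiberι f (2 * n) hUc γ W
    rw [← htr]
    exact isRationalClass_transportFun_of_isSmoothProjectiveFamily f (2 * n) dS hfam hSqp γ hQ₀
  -- every fibre is `δ`-charted
  have hch : HasWeilChartsOfDisc n d δ f W := by
    intro s
    obtain ⟨e'', a'', ha'', ha''0, hN''⟩ := hRfib s
    have hΨ : Ψ s ≫ Ψ s = -(d • 𝟙 (Y s)) := by
      rw [← natCast_zsmul]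
      exact (hYΨ s).2
    exact ⟨Y s, Ψ s, ε s, (hYΨ s).1, hΨ, (hWval s).2, e'', a'', ha'', ha''0, hN''⟩
  -- the anchor at `s₀`: the chart `(Y_{s₀}, Ψ_{s₀}, ε_{s₀})` with the transported class `u^* y`
  have hΨ₀ : Ψ s₀ ≫ Ψ s₀ = -(d • 𝟙 (Y s₀)) := by
    rw [← natCast_zsmul]
    exact (hYΨ s₀).2
  have hanch : antiCompatibleAnchor n d (fiberOver f s₀) (complexBetti.map (fiberι f s₀) (2 * n) W) :=
    ⟨Y s₀, Ψ s₀, ε s₀, (hYΨ s₀).1, hΨ₀, (hWval s₀).2, _, hy'a, hy'c, hy't⟩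
  exact ⟨𝒳, S, f, s₁, s₀, e', W, hfam, h𝒳, hSqp, hirr, hsm, fun s => ⟨hWQ s, (hWval s).1⟩, hch, hread, hanch⟩

/-! ## §5 (P) for every cell modulo J1; the registered stub; the exactness corollaries -/

/-- **TYPE-II POINTEDNESS OF EVERY CELL `(n, d, δ)`, `n, d ≥ 1`, MODULO J1 BY NAME** (L = the tree theorem
`deligne1968_invariantClass_fromTotalSpace_holds`; the cell's reach package = the template's `cellSystemReachAt_of_J1`).
SUPPORT theorem — J1 is an unproved named fact. [cite: Deligne1982HodgeCycles, §4, proof of Thm. 4.8]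
[cite: vanGeemen1994HodgeAV, 5.3–5.5 and 5.8–5.11] [cite: Deligne1968, Prop. (2.1) with (2.6.3)] [cite: Shimura1963AnalyticFamilies, §4] -/
theorem typeIIPointed_of_J1 (hJ : deligne1982_weilFamily_periodConstructionAtWeilType) (hn : 1 ≤ n) (hd : 1 ≤ d)
    (δ : weilNormResidueGroup d) : PointedWeilFamiliesComponent n d δ (antiCompatibleAnchor n d) :=
  typeIIPointed_of_cellSystemReachAt hn hd (cellSystemReachAt_of_J1 hJ hn hd δ) deligne1968_invariantClass_fromTotalSpace_holds

/-- **(P₆) on every non-split right-sign sixfold cell, modulo J1** (memo §5 task 2, the all-`(d, δ)` form; the binders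
`δ ≠ [(-1)³]`, `sign δ = (-1)³` are unused — (P) holds on every cell modulo J1). [cite: Deligne1982HodgeCycles, §4, proof of Thm. 4.8]
[cite: vanGeemen1994HodgeAV, 5.3–5.5] -/
theorem typeIIPointed_three_of_J1 (hJ : deligne1982_weilFamily_periodConstructionAtWeilType) :
    ∀ d : ℕ, 0 < d → ∀ δ : weilNormResidueGroup d, δ ≠ splitDiscriminantClass 3 d → weilSign d δ = (-1) ^ 3 →
      PointedWeilFamiliesComponent 3 d δ (antiCompatibleAnchor 3 d) :=
  fun _ hd δ _ _ => typeIIPointed_of_J1 hJ (by norm_num) hd δ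

/-- **THE REGISTERED STUB `stub_rung_firstCell_typeIIPointed` MODULO J1**: type-II pointedness of the first non-split cell
`(ℚ(√-3), 6, δ = [-2])` (the cell of the 6-dimensional PEL family `𝔔(D₆)`, `D₆ = (-3, 2)_ℚ`; the anchor fibre produced is the
cell's CM point `E₀³ × Ē₀³ ∈ 𝔔(D₆)` up to `K`-isogeny). SUPPORT theorem — J1 is a hypothesis. [cite: Deligne1982HodgeCycles, §4, proof of Thm. 4.8]
[cite: vanGeemen1994HodgeAV, 5.3–5.5] [cite: Shimura1963AnalyticFamilies, §4] -/
theorem typeII_firstCell_pointed_of_J1 (hJ : deligne1982_weilFamily_periodConstructionAtWeilType) :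
    PointedWeilFamiliesComponent 3 3
      (QuotientGroup.mk (Units.mk0 (-2 : ℚ) (by norm_num)) : weilNormResidueGroup 3) (antiCompatibleAnchor 3 3) :=
  typeIIPointed_of_J1 hJ (by norm_num) (by norm_num) _

/-- **EXACTNESS PER CELL MODULO J1: the cell's Hodge statement ↔ the local germ at the anti-compatible anchor**
(`n, d ≥ 1`, every `δ`; the anchor file's `weilClassesComponent_iff_localAtTypeII_of_typeIIPointed` fed (P) from J1).
[cite: CharlesSchnell2014Notes, Conj. 11.3.1 and Prop. 11.3.11] [cite: Deligne1982HodgeCycles, §4, proof of Thm. 4.8] -/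
theorem weilClassesComponent_iff_localAtTypeII_of_J1 (hJ : deligne1982_weilFamily_periodConstructionAtWeilType)
    (hn : 1 ≤ n) (hd : 1 ≤ d) (δ : weilNormResidueGroup d) :
    WeilClassesComponent n d δ ↔ LocalWeilVHCAtComponent n d δ (antiCompatibleAnchor n d) :=
  weilClassesComponent_iff_localAtTypeII_of_typeIIPointed hn hd (typeIIPointed_of_J1 hJ hn hd δ)

/-- **EXACTNESS PER CELL MODULO J1: the cell's VARIATIONAL instance ↔ the local germ at the anti-compatible anchor.**
[cite: CharlesSchnell2014Notes, Conj. 11.3.1 and Prop. 11.3.11] [cite: Deligne1982HodgeCycles, §4, proof of Thm. 4.8] -/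
theorem weilVariationalHodgeComponent_iff_localAtTypeII_of_J1 (hJ : deligne1982_weilFamily_periodConstructionAtWeilType)
    (hn : 1 ≤ n) (hd : 1 ≤ d) (δ : weilNormResidueGroup d) :
    WeilVariationalHodgeComponent n d δ ↔ LocalWeilVHCAtComponent n d δ (antiCompatibleAnchor n d) :=
  weilVariationalHodgeComponent_iff_localAtTypeII_of_typeIIPointed hn hd (typeIIPointed_of_J1 hJ hn hd δ)

/-- **K1 IS THE TYPE-II GERM STATEMENT, MODULO J1**: item stmt-HodgeConjecture-19149 `SplitImpliesAll.NonsplitSixfoldCells` ↔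
the local germ of the Weil algebraicity locus at anti-compatibly anchored fibres, on every non-split right-sign sixfold cell.
SUPPORT theorem; the germ is OPEN. [cite: CharlesSchnell2014Notes, Conj. 11.3.1 and Prop. 11.3.11]
[cite: Deligne1982HodgeCycles, §4, proof of Thm. 4.8] [cite: BuchweitzFlenner2003, Thm. 5.1] -/
theorem nonsplitSixfoldCells_iff_localAtTypeII_of_J1 (hJ : deligne1982_weilFamily_periodConstructionAtWeilType) :
    Summit.HodgeConjecture.HodgeConjecture.Theses.SplitImpliesAll.NonsplitSixfoldCells ↔
      ∀ d : ℕ, 0 < d → ∀ δ : weilNormResidueGroup d, δ ≠ splitDiscriminantClass 3 d → weilSign d δ = (-1) ^ 3 →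
        LocalWeilVHCAtComponent 3 d δ (antiCompatibleAnchor 3 d) :=
  nonsplitSixfoldCells_iff_localAtTypeII_of_typeIIPointed (typeIIPointed_three_of_J1 hJ)

/-- **`WeilSixfolds` IS THE TYPE-II GERM STATEMENT, MODULO J1 AND MARKMAN'S SPLIT THEOREM** (both hypotheses; Markman's is a
preprint). [cite: Markman2025SecantWeil, Thm. 1.5.1 (preprint, unrefereed)] [cite: Deligne1982HodgeCycles, §4, proof of Thm. 4.8]
[cite: CharlesSchnell2014Notes, Conj. 11.3.1 and Prop. 11.3.11] -/
theorem weilSixfolds_iff_localAtTypeII_of_J1_of_markman2025 (hJ : deligne1982_weilFamily_periodConstructionAtWeilType)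
    (hM : Markman2025_weilClasses_algebraic_hyperbolicSixfold) :
    Summit.HodgeConjecture.HodgeConjecture.Theses.SevenfoldWeilCensus.WeilSixfolds ↔
      ∀ d : ℕ, 0 < d → ∀ δ : weilNormResidueGroup d, δ ≠ splitDiscriminantClass 3 d → weilSign d δ = (-1) ^ 3 →
        LocalWeilVHCAtComponent 3 d δ (antiCompatibleAnchor 3 d) :=
  weilSixfolds_iff_localAtTypeII_of_markman2025_of_typeIIPointed hM (typeIIPointed_three_of_J1 hJ)

/-- **THE BC5 RUNG IN GERM CURRENCY, MODULO J1**: the plan-only rung `Lines/birth.lean: stub_rung_firstCell`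
(`WeilVariationalHodgeComponent 3 3 [-2]`) ↔ the registered germ stub `stub_rung_firstCell_typeIIGerm` (L₆), granted J1 —
the pointedness half `stub_rung_firstCell_typeIIPointed` being discharged modulo J1 above.
[cite: CharlesSchnell2014Notes, Prop. 11.3.11] [cite: Deligne1982HodgeCycles, §4, proof of Thm. 4.8] -/
theorem rung_firstCell_iff_typeIIGerm_of_J1 (hJ : deligne1982_weilFamily_periodConstructionAtWeilType) :
    WeilVariationalHodgeComponent 3 3 (QuotientGroup.mk (Units.mk0 (-2 : ℚ) (by norm_num)) : weilNormResidueGroup 3) ↔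
      LocalWeilVHCAtComponent 3 3
        (QuotientGroup.mk (Units.mk0 (-2 : ℚ) (by norm_num)) : weilNormResidueGroup 3) (antiCompatibleAnchor 3 3) :=
  weilVariationalHodgeComponent_iff_localAtTypeII_of_J1 hJ (by norm_num) (by norm_num) _

/-- **The BC5 rung from J1 and the germ (L₆) alone.** [cite: CharlesSchnell2014Notes, Prop. 11.3.11]
[cite: Deligne1982HodgeCycles, §4, proof of Thm. 4.8] -/
theorem rung_firstCell_of_J1_of_typeIIGerm (hJ : deligne1982_weilFamily_periodConstructionAtWeilType)
    (hL : LocalWeilVHCAtComponent 3 3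
      (QuotientGroup.mk (Units.mk0 (-2 : ℚ) (by norm_num)) : weilNormResidueGroup 3) (antiCompatibleAnchor 3 3)) :
    WeilVariationalHodgeComponent 3 3
      (QuotientGroup.mk (Units.mk0 (-2 : ℚ) (by norm_num)) : weilNormResidueGroup 3) :=
  rung_firstCell_of_typeIIPointed_of_local (typeII_firstCell_pointed_of_J1 hJ) hL

end Summit.HodgeConjecture.HodgeConjecture.Theorems.SplitImpliesAllTypeIIPointedOfJ1
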